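import Summits.HubbardSuperconductivity.HubbardSuperconductivity.Theorems.BalabanIRBirBdGPhaseCoercivityLyapunovBach

/-!
# Route BalabanIR — crux 3 `BirBdGPhaseCoercivity` (item `stmt-HubbardSuperconductivity-2081`):
# the Lyapunov (BCS-duality) deficit bound — the abstract theorem

THEOREM (`lyap_deficit`). Let `X₀ = [[h, C], [Cᴴ, -h]]`, `X = [[h, D], [Dᴴ, -h]]` with `h`
Hermitian, `E ≻ 0`, `E² = h² + C Cᴴ`, `C` normal and `h, C, E` pairwise commuting (so
`E ⊕ E = |X₀|`). For every real `Φ` with `0 ≤ 2 Re Tr (Dᴴ α) + Re Tr (αᴴ (E α + α E)) + Φ` for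
all `α` (i.e. `Φ ≥ ⟨D, 𝓛_E⁻¹ D⟩`, `𝓛_E(α) = E α + α E`):
  `Re Tr (E⁻¹ Cᴴ C) - 2 Φ ≤ Σ_i |λ_i(X₀)| - Σ_i |λ_i(X)|`.
PROOF (file `…LyapunovBach` supplies the pieces). For `0 ≤ Γ ≤ 1` with pairing block `α`:
`Tr (X Γ) = Tr (X₀ Γ) + 2 Re Tr ((D - C)ᴴ α)`; Bach's inequality and the block estimate at the
reference state `P = ½ (1 - X₀ (E ⊕ E)⁻¹)` (pairing block `-½ C E⁻¹`, gap equation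
`𝓛_E(½ C E⁻¹) = C`) give `⟨α + ½ C E⁻¹, 𝓛_E (α + ½ C E⁻¹)⟩ ≤ Tr (X₀ (Γ - P))`,
`Tr (X₀ P) = -½ Tr (E ⊕ E)`; expanding the quadratic form and inserting `hΦ`,
`-Tr (X Γ) ≤ Φ + ½ Tr (E ⊕ E) - ½ Re Tr (E⁻¹ Cᴴ C)`; finally `Tr (E ⊕ E) ≤ Σ|λ_i(X₀)|` (unitary
minorant) and `-Tr (X Γ) = ½ Σ|λ_i(X)|` at the negative spectral projection of `X`.
This is the `T = 0`, lattice form of the BCS-functional second-variation identity of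
Deuchert–Geisinger–Hainzl–Loss (Lemma 4.1) with the DESIGNED interaction `V = 𝓛_E`, for which the
stability form vanishes identically — so no Birman–Schwinger condition appears.

References: V. Bach, E. H. Lieb, J. P. Solovej, J. Stat. Phys. 76 (1994) 3; A. Deuchert,
A. Geisinger, C. Hainzl, M. Loss, Ann. Henri Poincaré 19 (2018) 1507, Lemma 4.1; C. Hainzl,
R. Seiringer, J. Math. Phys. 57 (2016) 021101, §2. No definition is introduced.
-/

noncomputable section

open scoped ComplexOrder

namespace Summit.HubbardSuperconductivity.HubbardSuperconductivity.Theorems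

namespace BirBdG

open Matrix

/-- **The Lyapunov (BCS-duality) deficit bound.** See the module docstring. With
`X₀ = [[h, C], [Cᴴ, -h]]`, `X = [[h, D], [Dᴴ, -h]]`, `E ≻ 0`, `E² = h² + C Cᴴ`, `C` normal and
`h, C, E` pairwise commuting: for every `Φ` dominating `⟨D, 𝓛_E⁻¹ D⟩` in the sense of `hΦ`,
`Re Tr (E⁻¹ Cᴴ C) - 2 Φ ≤ Σ_i |λ_i(X₀)| - Σ_i |λ_i(X)|`. [cite: DeuchertEtAl2018, Lemma 4.1] -/
theorem lyap_deficit {n : Type*} [Fintype n] [DecidableEq n] (h C D E : Matrix n n ℂ) (hh : h.IsHermitian) (hE : E.PosDef) (hEh : E * h = h * E) (hEC : E * C = C * E) (hhC : h * C = C * h) (hCC : C * Cᴴ = Cᴴ * C) (hsq : E * E = h * h + C * Cᴴ) (Φ : ℝ) (hΦ : ∀ α : Matrix n n ℂ, 0 ≤ 2 * (Dᴴ * α).trace.re + (αᴴ * (E * α + α * E)).trace.re + Φ) (hX₀ : (fromBlocks h C Cᴴ (-h)).IsHermitian) (hX : (fromBlocks h D Dᴴ (-h)).IsHermitian) : (E⁻¹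 * (Cᴴ * C)).trace.re - 2 * Φ ≤ ∑ i, |hX₀.eigenvalues i| - ∑ i, |hX.eigenvalues i| := by
  -- shorthand
  set X₀ : Matrix (n ⊕ n) (n ⊕ n) ℂ := fromBlocks h C Cᴴ (-h) with hX₀def
  set X : Matrix (n ⊕ n) (n ⊕ n) ℂ := fromBlocks h D Dᴴ (-h) with hXdef
  set M : Matrix (n ⊕ n) (n ⊕ n) ℂ := fromBlocks E 0 0 E with hMdef
  have hEH : E.IsHermitian := hE.isHermitian
  have hEdet : IsUnit E.det := (Matrix.isUnit_iff_isUnit_det E).1 hE.isUnit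
  have hEE : E * E⁻¹ = 1 := Matrix.mul_nonsing_inv E hEdet
  have hEE' : E⁻¹ * E = 1 := Matrix.nonsing_inv_mul E hEdet
  have hEiH : E⁻¹.IsHermitian := hEH.inv
  have hECh : E * Cᴴ = Cᴴ * E := by
    have := congrArg conjTranspose hEC
    simp only [conjTranspose_mul, hEH.eq] at this
    exact this.symm
  have hhCh : h * Cᴴ = Cᴴ * h := by
    have := congrArg conjTranspose hhC
    simp only [conjTranspose_mul, hh.eq] at this
    exact this.symm
  have hEiC : E⁻¹ * C = C * E⁻¹ := by
    calc E⁻¹ * C = E⁻¹ * C * (E * E⁻¹) := by rw [hEE, Matrix.mul_one]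
      _ = E⁻¹ * (C * E) * E⁻¹ := by simp only [Matrix.mul_assoc]
      _ = E⁻¹ * (E * C) * E⁻¹ := by rw [hEC]
      _ = C * E⁻¹ := by rw [← Matrix.mul_assoc, hEE', Matrix.one_mul]
  -- `M` is positive definite, commutes with `X₀`, and squares to `X₀²`
  have hM : M.PosDef := by
    rw [hMdef]
    refine PosDef.of_dotProduct_mulVec_pos (IsHermitian.fromBlocks hEH (by simp) hEH) ?_
    intro x hx
    set u : n → ℂ := fun i => x (Sum.inl i) with hu
    set v : n → ℂ := fun i => x (Sum.inr i) with hv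
    have hx' : x = Sum.elim u v := by
      ext i
      rcases i with i | i <;> rfl
    have hstar : star (Sum.elim u v) = Sum.elim (star u) (star v) := by
      ext i
      rcases i with i | i <;> rfl
    rw [hx', fromBlocks_mulVec, hstar]
    simp only [Matrix.zero_mulVec, add_zero, zero_add]
    rw [sumElim_dotProduct_sumElim]
    by_cases h0 : u = 0
    · have h2 : v ≠ 0 := by
        intro h2
        apply hx
        rw [hx', h0, h2]
        ext i
        rcases i with i | i <;> rfl
      rw [h0, star_zero, zero_dotProduct, zero_add]
      exact hE.dotProduct_mulVec_pos h2
    · exact add_pos_of_pos_of_nonneg (hE.dotProduct_mulVec_pos h0)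
        (hE.posSemidef.dotProduct_mulVec_nonneg v)
  have hcomm : X₀ * M = M * X₀ := by
    rw [hX₀def, hMdef, fromBlocks_multiply, fromBlocks_multiply]
    simp only [Matrix.mul_zero, Matrix.zero_mul, add_zero, zero_add, Matrix.neg_mul,
      Matrix.mul_neg, neg_zero, hEh, hEC, hECh]
  have hMsq : M * M = X₀ * X₀ := by
    rw [hX₀def, hMdef, fromBlocks_multiply, fromBlocks_multiply]
    simp only [Matrix.mul_zero, Matrix.zero_mul, add_zero, zero_add, Matrix.neg_mul,
      Matrix.mul_neg, neg_neg, hhC, hhCh, hsq, hCC, add_neg_cancel]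
    simp only [add_comm]
  have hMdet : IsUnit M.det := (Matrix.isUnit_iff_isUnit_det M).1 hM.isUnit
  have hMinv : M⁻¹ = fromBlocks E⁻¹ 0 0 E⁻¹ := by
    apply inv_eq_right_inv
    rw [hMdef, fromBlocks_multiply]
    simp only [Matrix.mul_zero, Matrix.zero_mul, add_zero, zero_add, hEE, fromBlocks_one]
  have hMM : M * M⁻¹ = 1 := Matrix.mul_nonsing_inv M hMdet
  -- the reference state `P` and its pairing block
  set P : Matrix (n ⊕ n) (n ⊕ n) ℂ := (1 / 2 : ℂ) • (1 - X₀ * M⁻¹) with hPdef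
  have hXM : X₀ * M⁻¹ = fromBlocks (h * E⁻¹) (C * E⁻¹) (Cᴴ * E⁻¹) (-(h * E⁻¹)) := by
    rw [hX₀def, hMinv, fromBlocks_multiply]
    simp only [Matrix.mul_zero, add_zero, zero_add, Matrix.neg_mul]
  have hPblocks : P = fromBlocks ((1 / 2 : ℂ) • (1 - h * E⁻¹)) (-(1 / 2 : ℂ) • (C * E⁻¹))
      (-(1 / 2 : ℂ) • (Cᴴ * E⁻¹)) ((1 / 2 : ℂ) • (1 + h * E⁻¹)) := by
    rw [hPdef, hXM, ← fromBlocks_one, sub_eq_add_neg, fromBlocks_neg, fromBlocks_add,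
      fromBlocks_smul]
    simp only [zero_sub, neg_neg, smul_neg, neg_smul, ← sub_eq_add_neg]
  have hP12 : P.toBlocks₁₂ = -(1 / 2 : ℂ) • (C * E⁻¹) := by
    rw [hPblocks, toBlocks_fromBlocks₁₂]
  have hPH : P.IsHermitian := by
    have h1 : (X₀ * M⁻¹).IsHermitian := by
      have hc' : M⁻¹ * X₀ = X₀ * M⁻¹ := by
        calc M⁻¹ * X₀ = M⁻¹ * X₀ * (M * M⁻¹) := by rw [hMM, Matrix.mul_one]
          _ = M⁻¹ * (X₀ * M) * M⁻¹ := by simp only [Matrix.mul_assoc]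
          _ = M⁻¹ * (M * X₀) * M⁻¹ := by rw [hcomm]
          _ = X₀ * M⁻¹ := by rw [← Matrix.mul_assoc, Matrix.nonsing_inv_mul M hMdet, Matrix.one_mul]
      change (X₀ * M⁻¹)ᴴ = X₀ * M⁻¹
      rw [conjTranspose_mul, hM.isHermitian.inv.eq, hX₀.eq, hc']
    have hhalf : star (1 / 2 : ℂ) = 1 / 2 := by simp
    change Pᴴ = P
    rw [hPdef, conjTranspose_smul, conjTranspose_sub, conjTranspose_one, h1.eq, hhalf]
  -- traces of `X₀`, `X`, `X₀ P`
  have htrX₀ : X₀.trace = 0 := by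
    rw [hX₀def, lyap_trace_fromBlocks, trace_neg, add_neg_cancel]
  have htrX : X.trace.re = 0 := by
    rw [hXdef, lyap_trace_fromBlocks, trace_neg, add_neg_cancel, Complex.zero_re]
  have htrX₀P : (X₀ * P).trace.re = -(M.trace.re) / 2 := by
    have : X₀ * P = (1 / 2 : ℂ) • (X₀ - M) := by
      rw [hPdef, Matrix.mul_smul, Matrix.mul_sub, Matrix.mul_one, ← Matrix.mul_assoc, ← hMsq,
        Matrix.mul_assoc, hMM, Matrix.mul_one]
    rw [this, trace_smul, trace_sub, htrX₀, zero_sub, smul_eq_mul,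
      show (1 / 2 : ℂ) = ((1 / 2 : ℝ) : ℂ) by push_cast; ring, Complex.re_ofReal_mul, Complex.neg_re]
    ring
  -- `Tr M ≤ S(X₀)` (unitary minorant at `V = X₀ M⁻¹`)
  have hTrM : M.trace.re ≤ ∑ i, |hX₀.eigenvalues i| := by
    have hV : X₀ * M⁻¹ ∈ Matrix.unitaryGroup (n ⊕ n) ℂ := by
      rw [Matrix.mem_unitaryGroup_iff']
      rw [star_eq_conjTranspose, Matrix.conjTranspose_mul, hM.isHermitian.inv.eq, hX₀.eq]
      calc M⁻¹ * X₀ * (X₀ * M⁻¹) = M⁻¹ * (X₀ * X₀) * M⁻¹ := by simp only [Matrix.mul_assoc]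
        _ = M⁻¹ * (M * M) * M⁻¹ := by rw [hMsq]
        _ = 1 := by rw [← Matrix.mul_assoc, Matrix.nonsing_inv_mul M hMdet, Matrix.one_mul, hMM]
    have hlow := re_trace_mul_unitary_le_sum_abs_eigenvalues X₀ (X₀ * M⁻¹) hX₀ hV
    have htrV : (X₀ * (X₀ * M⁻¹)).trace = M.trace := by
      rw [← Matrix.mul_assoc, ← hMsq, Matrix.mul_assoc, hMM, Matrix.mul_one]
    rw [htrV] at hlow
    exact hlow
  -- the core inequality for every admissible `Γ`
  have hcore : ∀ Γ : Matrix (n ⊕ n) (n ⊕ n) ℂ, Γ.PosSemidef → (1 - Γ).PosSemidef →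
      -(X * Γ).trace.re ≤ Φ + M.trace.re / 2 - (E⁻¹ * (Cᴴ * C)).trace.re / 2 := by
    intro Γ hΓ hΓ'
    have hΓH : Γ.IsHermitian := hΓ.1
    -- Bach + the block estimate
    have hbach : (M * ((Γ - P) * (Γ - P))).trace.re ≤ (X₀ * (Γ - P)).trace.re :=
      lyap_bach X₀ M Γ hX₀ hM hcomm hMsq hΓ hΓ'
    set Y : Matrix (n ⊕ n) (n ⊕ n) ℂ := Γ - P with hYdef
    have hYH : Y.IsHermitian := hΓH.sub hPH
    have hY21 : Y.toBlocks₂₁ = (Y.toBlocks₁₂)ᴴ := by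
      ext i j
      simp only [toBlocks₂₁, toBlocks₁₂, conjTranspose_apply, of_apply]
      exact (hYH.apply _ _).symm
    have hY11 : (Y.toBlocks₁₁).IsHermitian := by
      ext i j
      simp only [toBlocks₁₁, conjTranspose_apply, of_apply]
      exact hYH.apply _ _
    have hY22 : (Y.toBlocks₂₂).IsHermitian := by
      ext i j
      simp only [toBlocks₂₂, conjTranspose_apply, of_apply]
      exact hYH.apply _ _
    have hYblocks : Y = fromBlocks Y.toBlocks₁₁ Y.toBlocks₁₂ (Y.toBlocks₁₂)ᴴ Y.toBlocks₂₂ := by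
      conv_lhs => rw [← fromBlocks_toBlocks Y]
      rw [hY21]
    have hblock := lyap_block_trace_ge E Y.toBlocks₁₁ Y.toBlocks₁₂ Y.toBlocks₂₂ hE.posSemidef hY11 hY22
    rw [← hYblocks, ← hMdef] at hblock
    have hchain : ((Y.toBlocks₁₂)ᴴ * (E * Y.toBlocks₁₂ + Y.toBlocks₁₂ * E)).trace.re ≤
        (X₀ * Γ).trace.re + M.trace.re / 2 := by
      have := le_trans hblock hbach
      rw [Matrix.mul_sub X₀ Γ P, trace_sub, Complex.sub_re, htrX₀P] at this
      linarith
    -- the pairing block of `Y` is `α + ½ C E⁻¹`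
    set α : Matrix n n ℂ := Γ.toBlocks₁₂ with hαdef
    set γ : Matrix n n ℂ := (1 / 2 : ℂ) • (C * E⁻¹) with hγdef
    have hβ : Y.toBlocks₁₂ = α + γ := by
      rw [hYdef]
      have : (Γ - P).toBlocks₁₂ = Γ.toBlocks₁₂ - P.toBlocks₁₂ := by
        ext i j; rfl
      rw [this, hP12, neg_smul, sub_neg_eq_add, hαdef, hγdef]
    -- the gap equation `𝓛_E γ = C` and the value `⟨γ, 𝓛_E γ⟩ = ½ Re Tr (E⁻¹ Cᴴ C)`
    have hgap : E * γ + γ * E = C := by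
      rw [hγdef, Matrix.mul_smul, Matrix.smul_mul, ← smul_add, ← Matrix.mul_assoc, hEC,
        Matrix.mul_assoc, hEE, Matrix.mul_one, Matrix.mul_assoc, hEE', Matrix.mul_one, ← two_smul ℂ C,
        smul_smul]
      norm_num
    have hγval : (γᴴ * (E * γ + γ * E)).trace.re = (E⁻¹ * (Cᴴ * C)).trace.re / 2 := by
      have hhalf : star (1 / 2 : ℂ) = 1 / 2 := by simp
      rw [hgap, hγdef, conjTranspose_smul, conjTranspose_mul, hEiH.eq, Matrix.smul_mul, trace_smul,
        Matrix.mul_assoc, smul_eq_mul, hhalf,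
        show (1 / 2 : ℂ) = ((1 / 2 : ℝ) : ℂ) by push_cast; ring, Complex.re_ofReal_mul]
      ring
    have hcrossval : (αᴴ * (E * γ + γ * E)).trace.re = (Cᴴ * α).trace.re := by
      rw [hgap]
      have : (αᴴ * C).trace = star ((Cᴴ * α).trace) := by
        rw [← trace_conjTranspose, conjTranspose_mul, conjTranspose_conjTranspose]
      rw [this]
      simp only [Complex.star_def, Complex.conj_re]
    rw [hβ, lyap_quad_expand E α γ hEH, hγval, hcrossval] at hchain
    -- `Tr (X₀ Γ) = Tr (X Γ) - 2 Re Tr ((D - C)ᴴ α)`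
    have hXX₀ : X = X₀ + fromBlocks 0 (D - C) (D - C)ᴴ 0 := by
      rw [hXdef, hX₀def, fromBlocks_add]
      simp only [add_zero, conjTranspose_sub, add_sub_cancel]
    have htrXΓ : (X * Γ).trace.re = (X₀ * Γ).trace.re + 2 * (Dᴴ * α).trace.re - 2 * (Cᴴ * α).trace.re := by
      rw [hXX₀, Matrix.add_mul, trace_add, Complex.add_re, lyap_re_trace_offDiag_mul (D - C) Γ hΓH,
        conjTranspose_sub, Matrix.sub_mul, trace_sub, Complex.sub_re]
      ring
    have hΦα := hΦ α
    linarith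
  -- evaluate at the negative spectral projection of `X`
  obtain ⟨Γ, hΓ, hΓ', hval⟩ := lyap_exists_negProj X hX htrX
  have := hcore Γ hΓ hΓ'
  rw [hval] at this
  linarith

end BirBdG

end Summit.HubbardSuperconductivity.HubbardSuperconductivity.Theorems

end
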